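import Summits.AtomisticToContinuum.Crystallization.Theorems.FreeSplittingCertificatesRadiusLadderRadiusFloorApprox

/-!
# Radius ladder for `ApproxFiniteRangeSplitting`: `δ_½(ε) > 0` for EVERY tolerance `ε` (ring stars)

Route `FreeSplittingCertificates`, crux r5 `ApproxFiniteRangeSplitting` (stmt-AtomisticToContinuum-12562), the
`ε`-version of crux r2 `FiniteRangeSplitting` (stmt-AtomisticToContinuum-12559); block-2b unit `b2b-freesplit`, PART A
gen 18.  Value = a structural theorem about the cruxes' instances — NOT summit progress.

`…RadiusLadderRadiusFloorApprox` introduced the `ε`-deepest-site threshold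
`δ_½(ε) = approxHalfSumThreshold ε = inf {δ > 0 | AHalfSumFeasible δ ε}` (the hard core from which on the BLIND rule
`Φ ≡ ½` is an `ε`-rung at every radius) and proved it positive and attained only for `ε < 1/200` (star prices).
Here we remove that restriction with a one-line configuration family, the **ring stars**: a centre together with
`M` rational points `c(t) = ((1 - t²)/(1 + t²), 2t/(1 + t²), 0)`, `t = 1, …, M`, of the unit circle.  The centre's
half pair-sum is `M · V_LJ(1) / 2 = -M/24`, the configuration is `2/(1 + M²)²`-separated (two outer points differ by
`2(t² - s²)/((1 + s²)(1 + t²)) ≥ 2/(1 + M²)²` in the first coordinate), and `-M/24 < B - ε ≤ e_∞ - ε` as soon as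
`M > 24 (ε - B)` (`B = twoConeB ≤ e_∞`, the tree's two-cone bound).  Hence:

* `exists_pos_not_aHalfSumFeasible`: for EVERY `ε : ℝ` some positive hard core violates the `ε`-deepest-site
  inequality; `approxHalfSumThreshold_pos_of_nonneg`: **`δ_½(ε) > 0` for every `ε ≥ 0`**, with the explicit floor
  `2/(1 + M²)² ≤ δ_½(ε)` for `M > 24 (ε - B)` (`le_approxHalfSumThreshold_ringStar`);
* consequently the threshold is ATTAINED for every `ε ≥ 0` (`aHalfSumFeasible_approxThreshold`) and the `ε`-half
  set is exactly the closed ray `[δ_½(ε), ∞)` (`aHalfSet_eq_Ici`);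
* read on crux r5: NO tolerance makes blind rules work at all hard cores — for every `ε` there is `δ > 0` with
  `¬ ARungAt δ ε R` for every `R < δ` (`exists_pos_forall_not_arungAt`, `not_forall_arungAt_zero`); so the window
  form `approxFiniteRangeSplitting_iff_window_floor` is never vacuous: at every tolerance `ε > 0` the hard cores
  `δ ∈ (0, δ_½(ε))` form a nonempty interval on which every witness of crux r5 reads radius `R ≥ δ_½(ε) > 0`
  (`exists_floor_interval`).

Tolerance never substitutes for information: exactly as for crux r2 (`δ_½ > 0`), an `ε`-certificate at a small
hard core must read the pattern.  (The lj-lp lane's explicit-rule verdicts V6/V7 say more — every COBOUNDARY rule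
`w = clip(½ + κ (D_j - D_i))` is dead for every `κ` at radii up to `5a` — but those are certificates on named
configurations, not tree theorems.)
-/

noncomputable section

namespace Summit.AtomisticToContinuum.Crystallization.Theorems.StrictSplittingRuleBirth

open scoped BigOperators Classical
open Literature.MathematicalPhysics.StatisticalMechanics

/-! ## 1. Ring stars -/

namespace RingStar

/-- `c(t) = ((1 - t²)/(1 + t²), 2t/(1 + t²), 0)` lies on the unit sphere. [folklore] -/
theorem ring_sq_sum (t : ℝ) :
    ((1 - t ^ 2) / (1 + t ^ 2)) ^ 2 + (2 * t / (1 + t ^ 2)) ^ 2 + (0 : ℝ) ^ 2 = 1 := by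
  have h : (1 : ℝ) + t ^ 2 ≠ 0 := by positivity
  field_simp
  ring

/-- Two ring points `c(s)`, `c(t)` with `s < t ≤ M` differ by at least `2/(1 + M²)²` in the first coordinate:
`c(s)₀ - c(t)₀ = 2 (t² - s²) / ((1 + s²)(1 + t²))`. [folklore] -/
theorem ring_first_sub_of_lt {M s t : ℕ} (ht : t ≤ M) (hst : s < t) :
    2 / ((1 : ℝ) + (M : ℝ) ^ 2) ^ 2 ≤
      (1 - (s : ℝ) ^ 2) / (1 + (s : ℝ) ^ 2) - (1 - (t : ℝ) ^ 2) / (1 + (t : ℝ) ^ 2) := by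
  have hs1 : (0 : ℝ) < 1 + (s : ℝ) ^ 2 := by positivity
  have ht1 : (0 : ℝ) < 1 + (t : ℝ) ^ 2 := by positivity
  have hdiff : (1 - (s : ℝ) ^ 2) / (1 + (s : ℝ) ^ 2) - (1 - (t : ℝ) ^ 2) / (1 + (t : ℝ) ^ 2)
      = 2 * ((t : ℝ) ^ 2 - (s : ℝ) ^ 2) / ((1 + (s : ℝ) ^ 2) * (1 + (t : ℝ) ^ 2)) := by
    field_simp
    ring
  rw [hdiff, div_le_div_iff₀ (by positivity) (mul_pos hs1 ht1)]
  have hst' : (s : ℝ) + 1 ≤ t := by exact_mod_cast hst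
  have htM : (t : ℝ) ≤ M := by exact_mod_cast ht
  have hs0 : (0 : ℝ) ≤ s := Nat.cast_nonneg s
  have h3 : (1 : ℝ) ≤ (t : ℝ) ^ 2 - (s : ℝ) ^ 2 := by nlinarith
  have h1 : 1 + (s : ℝ) ^ 2 ≤ 1 + (M : ℝ) ^ 2 := by nlinarith
  have h2 : 1 + (t : ℝ) ^ 2 ≤ 1 + (M : ℝ) ^ 2 := by nlinarith
  have hM0 : (0 : ℝ) ≤ 1 + (M : ℝ) ^ 2 := by positivity
  have h12 : (1 + (s : ℝ) ^ 2) * (1 + (t : ℝ) ^ 2) ≤ (1 + (M : ℝ) ^ 2) ^ 2 :=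
    calc (1 + (s : ℝ) ^ 2) * (1 + (t : ℝ) ^ 2) ≤ (1 + (M : ℝ) ^ 2) * (1 + (M : ℝ) ^ 2) :=
          mul_le_mul h1 h2 ht1.le hM0
      _ = (1 + (M : ℝ) ^ 2) ^ 2 := (sq _).symm
  have h4 : (1 : ℝ) * (1 + (M : ℝ) ^ 2) ^ 2 ≤ ((t : ℝ) ^ 2 - (s : ℝ) ^ 2) * (1 + (M : ℝ) ^ 2) ^ 2 :=
    mul_le_mul_of_nonneg_right h3 (by positivity)
  nlinarith [h12, h4]

/-- Symmetric form: distinct ring points `c(s)`, `c(t)`, `s, t ≤ M`, differ by `≥ 2/(1 + M²)²` in the first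
coordinate. [folklore] -/
theorem ring_abs_first_sub {M s t : ℕ} (hs : s ≤ M) (ht : t ≤ M) (hst : s ≠ t) :
    2 / ((1 : ℝ) + (M : ℝ) ^ 2) ^ 2 ≤
      |(1 - (s : ℝ) ^ 2) / (1 + (s : ℝ) ^ 2) - (1 - (t : ℝ) ^ 2) / (1 + (t : ℝ) ^ 2)| := by
  rcases lt_or_gt_of_ne hst with h | h
  · exact (ring_first_sub_of_lt ht h).trans (le_abs_self _)
  · rw [abs_sub_comm]
    exact (ring_first_sub_of_lt hs h).trans (le_abs_self _)

/-- The coordinate table of the ring star with `M` outer points: site `0` is the origin, site `k ≥ 1` is `c(k)`.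
[folklore] -/
theorem exists_coords (M : ℕ) :
    ∃ x : Fin (M + 1) → EuclideanSpace ℝ (Fin 3), (∀ c : Fin 3, x 0 c = 0) ∧
      ∀ k : Fin (M + 1), k ≠ 0 →
        x k 0 = (1 - ((k : ℕ) : ℝ) ^ 2) / (1 + ((k : ℕ) : ℝ) ^ 2) ∧
          x k 1 = 2 * ((k : ℕ) : ℝ) / (1 + ((k : ℕ) : ℝ) ^ 2) ∧ x k 2 = 0 :=
  ⟨fun k => WithLp.toLp 2 (if k = 0 then (0 : Fin 3 → ℝ) else
      ![(1 - ((k : ℕ) : ℝ) ^ 2) / (1 + ((k : ℕ) : ℝ) ^ 2), 2 * ((k : ℕ) : ℝ) / (1 + ((k : ℕ) : ℝ) ^ 2), 0]),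
    fun c => by simp only [if_true, Pi.zero_apply],
    fun k hk => by
      simp only [hk, if_false, Matrix.cons_val_zero, Matrix.cons_val_one, Matrix.cons_val_two,
        Matrix.head_cons, Matrix.tail_cons, and_self]⟩

/-- **Ring stars.**  For every `M` there is a `2/(1 + M²)²`-separated configuration of `M + 1` points whose site `0`
has all `M` other points at distance exactly `1`, hence half pair-sum `M · V_LJ(1) / 2 = -M/24`. [folklore] -/
theorem exists_ringStar (M : ℕ) :
    ∃ x : Fin (M + 1) → EuclideanSpace ℝ (Fin 3), Sep (2 / ((1 : ℝ) + (M : ℝ) ^ 2) ^ 2) x ∧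
      (∀ j : Fin (M + 1), j ≠ 0 → dist (x 0) (x j) = 1) ∧
      (∑ j ∈ Finset.univ.erase 0, lennardJones (dist (x 0) (x j))) / 2 = -((M : ℝ) / 24) := by
  obtain ⟨x, hx0, hxk⟩ := exists_coords M
  -- every outer point is at distance `1` from the centre
  have hdist : ∀ j : Fin (M + 1), j ≠ 0 → dist (x 0) (x j) = 1 := by
    intro j hj
    obtain ⟨h0, h1, h2⟩ := hxk j hj
    rw [EuclideanSpace.dist_eq, Fin.sum_univ_three]
    simp only [hx0, Real.dist_eq, zero_sub, abs_neg, sq_abs, h0, h1, h2]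
    rw [ring_sq_sum, Real.sqrt_one]
  refine ⟨x, ?_, hdist, ?_⟩
  · -- separation
    intro i j hij
    have hM : (1 : ℝ) ≤ M := by
      rcases Nat.eq_zero_or_pos M with h | h
      · subst h
        exfalso
        apply hij
        apply Fin.ext
        have h1 := i.is_lt
        have h2 := j.is_lt
        omega
      · exact_mod_cast h
    have hb1 : 2 / ((1 : ℝ) + (M : ℝ) ^ 2) ^ 2 ≤ 1 := by
      rw [div_le_one (by positivity)]
      nlinarith
    by_cases hi : i = 0
    · subst hi
      rw [hdist j (Ne.symm hij)]
      exact hb1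
    · by_cases hj : j = 0
      · subst hj
        rw [dist_comm, hdist i hi]
        exact hb1
      · -- a coordinate difference bounds the Euclidean distance from below (inlined: the tree's
        -- `PeriodicWindowsSketch.gl_coord_sub_le_dist` lives in an unrelated route's module)
        have hcoord : ∀ y z : EuclideanSpace ℝ (Fin 3), |y 0 - z 0| ≤ dist y z := by
          intro y z
          rw [EuclideanSpace.dist_eq, ← Real.sqrt_sq (abs_nonneg (y 0 - z 0)), sq_abs]
          refine Real.sqrt_le_sqrt ?_
          have h : (y 0 - z 0) ^ 2 = dist (y 0) (z 0) ^ 2 := by rw [Real.dist_eq, sq_abs]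
          rw [h]
          exact Finset.single_le_sum (f := fun l => dist (y l) (z l) ^ 2) (fun l _ => sq_nonneg _)
            (Finset.mem_univ 0)
        calc 2 / ((1 : ℝ) + (M : ℝ) ^ 2) ^ 2 ≤ |x i 0 - x j 0| := by
              rw [(hxk i hi).1, (hxk j hj).1]
              exact ring_abs_first_sub (Nat.lt_succ_iff.mp i.is_lt) (Nat.lt_succ_iff.mp j.is_lt)
                (Fin.val_ne_of_ne hij)
          _ ≤ dist (x i) (x j) := hcoord _ _
  · -- the centre's half pair-sum
    have h : ∀ j ∈ Finset.univ.erase (0 : Fin (M + 1)), lennardJones (dist (x 0) (x j)) = -1 / 12 := by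
      intro j hj
      rw [hdist j (Finset.ne_of_mem_erase hj), lennardJones_one]
    rw [Finset.sum_congr rfl h, Finset.sum_const, Finset.card_erase_of_mem (Finset.mem_univ _),
      Finset.card_univ, Fintype.card_fin, Nat.add_sub_cancel, nsmul_eq_mul]
    ring

end RingStar

/-! ## 2. `δ_½(ε) > 0` for every `ε` -/

/-- **Ring stars violate the `ε`-deepest-site inequality**: at hard core `2/(1 + M²)²` the `ε`-half rule fails as
soon as `ε < M/24 + B` (`B = twoConeB ≤ e_∞`). -/
theorem not_aHalfSumFeasible_ringStar {M : ℕ} {ε : ℝ} (hε : ε < (M : ℝ) / 24 + twoConeB) :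
    ¬ AHalfSumFeasible (2 / ((1 : ℝ) + (M : ℝ) ^ 2) ^ 2) ε := by
  intro hf
  obtain ⟨x, hsep, -, hsum⟩ := RingStar.exists_ringStar M
  have h := hf (M + 1) x hsep 0
  rw [hsum] at h
  have hB := twoConeB_le_eInf
  linarith

/-- **For every tolerance `ε` some positive hard core violates the `ε`-deepest-site inequality** (ring star with
`M > 24 (ε - B)` outer points). -/
theorem exists_pos_not_aHalfSumFeasible (ε : ℝ) : ∃ δ : ℝ, 0 < δ ∧ ¬ AHalfSumFeasible δ ε := by
  obtain ⟨M, hM⟩ := exists_nat_gt (24 * (ε - twoConeB))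
  exact ⟨2 / ((1 : ℝ) + (M : ℝ) ^ 2) ^ 2, by positivity,
    not_aHalfSumFeasible_ringStar (M := M) (by linarith)⟩

/-- **`δ_½(ε) > 0` for every `ε ≥ 0`** (removes the restriction `ε < 1/200` of `approxHalfSumThreshold_pos`). -/
theorem approxHalfSumThreshold_pos_of_nonneg {ε : ℝ} (hε : 0 ≤ ε) : 0 < approxHalfSumThreshold ε := by
  obtain ⟨δ, hδ, hnot⟩ := exists_pos_not_aHalfSumFeasible ε
  exact hδ.trans_le (le_approxHalfSumThreshold_of_not hε hnot)

/-- Explicit floor: `2/(1 + M²)² ≤ δ_½(ε)` whenever `M > 24 (ε - B)` (`ε ≥ 0`). -/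
theorem le_approxHalfSumThreshold_ringStar {ε : ℝ} (hε : 0 ≤ ε) {M : ℕ} (hM : ε < (M : ℝ) / 24 + twoConeB) :
    2 / ((1 : ℝ) + (M : ℝ) ^ 2) ^ 2 ≤ approxHalfSumThreshold ε :=
  le_approxHalfSumThreshold_of_not hε (not_aHalfSumFeasible_ringStar hM)

/-- **`δ_½(ε)` is attained for every `ε ≥ 0`**: the `ε`-deepest-site inequality holds AT the threshold
(unconditional form of `aHalfSumFeasible_approxHalfSumThreshold`). -/
theorem aHalfSumFeasible_approxThreshold {ε : ℝ} (hε : 0 ≤ ε) :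
    AHalfSumFeasible (approxHalfSumThreshold ε) ε :=
  aHalfSumFeasible_approxHalfSumThreshold hε (approxHalfSumThreshold_pos_of_nonneg hε)

/-- **The `ε`-half set is exactly the closed ray `[δ_½(ε), ∞)`** with positive endpoint (`ε ≥ 0`). -/
theorem aHalfSet_eq_Ici {ε : ℝ} (hε : 0 ≤ ε) : AHalfSet ε = Set.Ici (approxHalfSumThreshold ε) := by
  ext δ
  refine ⟨fun h => approxHalfSumThreshold_le_of h.1 h.2, fun h => ?_⟩
  have hδ : 0 < δ := (approxHalfSumThreshold_pos_of_nonneg hε).trans_le h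
  exact ⟨hδ, (aHalfSumFeasible_iff_threshold_le hε hδ).2 h⟩

/-- The blind rule at the threshold: for every `ε ≥ 0`, `Φ ≡ ½` is an `ε`-rung at hard core `δ_½(ε)` and every
radius, and at no smaller positive hard core for radii below the hard core. -/
theorem arungAt_approxThreshold {ε : ℝ} (hε : 0 ≤ ε) (R : ℝ) : ARungAt (approxHalfSumThreshold ε) ε R :=
  arungAt_of_aHalfSumFeasible (aHalfSumFeasible_approxThreshold hε) R

/-! ## 3. Read on crux r5: tolerance never substitutes for reading the pattern -/

/-- **No tolerance makes blind rules work at all hard cores**: for every `ε` there is a hard core `δ > 0` at which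
no rule of reading radius `R < δ` is an `ε`-rung. -/
theorem exists_pos_forall_not_arungAt (ε : ℝ) : ∃ δ : ℝ, 0 < δ ∧ ∀ R : ℝ, R < δ → ¬ ARungAt δ ε R := by
  obtain ⟨δ, hδ, hnot⟩ := exists_pos_not_aHalfSumFeasible ε
  exact ⟨δ, hδ, fun R hR h => hnot ((arungAt_iff_aHalfSumFeasible_of_lt hδ hR).mp h)⟩

/-- In particular the radius-`0` (blind) version of crux r5 is FALSE at every single tolerance `ε`. -/
theorem not_forall_arungAt_zero (ε : ℝ) : ¬ ∀ δ : ℝ, 0 < δ → ARungAt δ ε 0 := by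
  obtain ⟨δ, hδ, hnot⟩ := exists_pos_forall_not_arungAt ε
  exact fun h => hnot 0 hδ (h δ hδ)

/-- **The floor interval is never empty.**  For every `ε ≥ 0` there is `δ₀ > 0` (namely `δ_½(ε)`) such that at every
hard core `δ ∈ (0, δ₀)` every `ε`-rung reads radius `R ≥ δ₀`, while at `δ₀` itself every radius carries an `ε`-rung. -/
theorem exists_floor_interval {ε : ℝ} (hε : 0 ≤ ε) :
    ∃ δ₀ : ℝ, 0 < δ₀ ∧ (∀ R : ℝ, ARungAt δ₀ ε R) ∧
      ∀ δ : ℝ, 0 < δ → δ < δ₀ → ∀ R : ℝ, ARungAt δ ε R → δ₀ ≤ R :=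
  ⟨approxHalfSumThreshold ε, approxHalfSumThreshold_pos_of_nonneg hε, arungAt_approxThreshold hε,
    fun _ hδ hlt _ h => approxThreshold_le_radius_of_arungAt hδ hlt h⟩

end Summit.AtomisticToContinuum.Crystallization.Theorems.StrictSplittingRuleBirth

end
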